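import HarnessLib
import Summits.QuantumFields.YangMills.Theorems.PencilRigidityHypercubicLimitDefs
import Summits.QuantumFields.YangMills.Theorems.LangevinControlUVOSLegsFromFemtoAndGapDefs
import Summits.QuantumFields.YangMills.Theorems.LangevinControlUVOSLegsFromFemtoAndGapStubAssemblyLatticeDist
import Summits.QuantumFields.YangMills.Theorems.LangevinControlUVOSLegsFromFemtoAndGapStubAssemblyInheritance
import Summits.QuantumFields.YangMills.Theorems.LangevinControlUVOSLegsFromFemtoAndGapStubAssemblyPlaneStrings

/-!
# Crux `HypercubicLimit` (stmt-QuantumFields-8646), line `conditional-mean-telescoping`: stub `translate_scaledLimit`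

Translation invariance on `⁰𝒮` of subsequential limits `Φ` of the SCALED plane-string lattice distributions
`λ_k · latticeDistStr r.ρ β_k L_k a_k (planeObs r ∘ q) (means)` (`|λ_k| ≤ a_k^{-J}`), given a `k`-uniform
E0′-type bound on `⁰𝒮`.  The argument is the sibling's `limit_isNormalized_isSymmetric_translate`
(`Theorems/LangevinControlUVOSLegsFromFemtoAndGapStubAssemblyInheritance.lean`) with one change: the wrap-zone
translation defect of `latticeDistStr` under a lattice vector `a_k ⌊t/a_k⌋` is taken at Schwartz decay order
`8n + J + 1` instead of `8n + 1` (`norm_latticeDistStr_translate_sub_le_pow`), which makes it `O(a_k^{J+1})` and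
hence `O(a_k)` after multiplication by `λ_k`; the remainder `t - a_k⌊t/a_k⌋ → 0` is absorbed by the uniform bound
and the strong continuity of translations on `𝓢` (`translate_eq_of_asymptotic`, the tree's
`translateMulti_apply_eq_of_tendsto` for a fixed arity and a merely additive sequence of functionals).
-/

set_option autoImplicit false

noncomputable section

open scoped SchwartzMap ENNReal
open MeasureTheory Filter Topology
open Literature.MathematicalPhysics.AQFT Literature.MathematicalPhysics.QuantumLattice
open Literature.MathematicalPhysics.QuantumFieldTheory
open Literature.Probability.LatticeModels (box Site)
open Summit.QuantumFields.YangMills.Theorems.HypercubicLimit.Negative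
  (torusPlaquette torusDensity rpSquare influence)
open Summit.QuantumFields.YangMills.Theorems.OSLegsFromFemtoAndGap (torusMomentStr latticeDistStr latticeDist)
open Summit.QuantumFields.YangMills.Cruxes.OSLegsFromFemtoAndGap.DlrCollarTransfer (Q2 Q3)
open Summit.QuantumFields.YangMills.Theorems.OSLegsFromFemtoAndGap
  (latticeDistStr_apply torusMomentStr_add_const norm_apply_le_seminorm_div exists_lt_norm_of_not_mem_piFinset_box
    mul_norm_le_norm_smul_siteToE norm_smul_siteToE_floor_sub_le norm_floor_le abs_torusMomentStr_plane_le)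
open Summit.QuantumFields.YangMills.Cruxes.OSLegsFromFemtoAndGap.DlrCollarTransfer (exists_abs_plane_le)

namespace Summit.QuantumFields.YangMills.Cruxes.HypercubicLimit.ConditionalMeanTelescoping

local notation "E4" => EuclideanSpace ℝ (Fin 4)

/-! ### The translation defect of `latticeDistStr` at an arbitrary Schwartz decay order -/

section Defect

variable {G : Type} [Group G] [TopologicalSpace G] [IsTopologicalGroup G] [CompactSpace G]
  [MeasurableSpace G] [BorelSpace G]

/-- **The translation defect at decay order `8n + J + 1`.**  Given the sup bound `|W| ≤ Mⁿ` on the weights,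
translating the test function by a lattice vector `a v` with `2‖v‖ ≤ L` changes `latticeDistStr … F` only through
the wrap zone: for `0 < a ≤ 1` and `L ≥ a⁻²`,
`‖T(F(· − a v)) − T(F)‖ ≤ 2·3⁴ⁿ·2^{8n+J+1}·Mⁿ·‖F‖_{8n+J+1,0}·a^{J+1}` (the sibling's
`norm_latticeDistStr_translate_sub_le` is the case `J = 0`; same proof, `L^{4n}/(aL/2)^{8n+J+1} ≤ 3^{4n}2^{8n+J+1}a^{J+1}`
by `L ≥ a⁻²`). -/
theorem norm_latticeDistStr_translate_sub_le_pow {N : ℕ} (ρ : G →* Matrix (Fin N) (Fin N) ℂ) (β : ℝ) (L : ℕ)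
    {n : ℕ} (O : Fin n → LGConfig 4 G → ℝ) (m : Fin n → ℝ) {M : ℝ} (hM : 0 ≤ M)
    (hW : ∀ x : Fin n → Site 4, |torusMomentStr ρ β L O m x| ≤ M ^ n) {a : ℝ} (ha : 0 < a) (ha1 : a ≤ 1)
    (hLa : a⁻¹ * a⁻¹ ≤ L) (v : Site 4) (hv : 2 * ‖v‖ ≤ (L : ℝ)) (J : ℕ) (F : 𝓢((Fin n → E4), ℂ)) :
    ‖latticeDistStr ρ β L a O m (translateMulti (a • siteToE v) F) - latticeDistStr ρ β L a O m F‖ ≤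
      2 * 3 ^ (4 * n) * 2 ^ (8 * n + J + 1) * M ^ n * SchwartzMap.seminorm ℂ (8 * n + J + 1) 0 F *
        a ^ (J + 1) := by
  classical
  -- adapted from `norm_latticeDistStr_translate_sub_le` (toolkit VIII-a of the sibling crux)
  set S₁ : Finset (Fin n → Site 4) := Fintype.piFinset (fun _ : Fin n => box 4 L) with hS₁
  set vv : Fin n → Site 4 := fun _ => v with hvv
  set e : (Fin n → Site 4) ≃ (Fin n → Site 4) := Equiv.subRight vv with he
  set S₂ : Finset (Fin n → Site 4) := S₁.map e.toEmbedding with hS₂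
  set g : (Fin n → Site 4) → ℂ := fun y =>
    ((torusMomentStr ρ β L O m y : ℝ) : ℂ) * F (fun i => a • siteToE (y i)) with hg
  -- Step 1: the translated distribution is the same sum over the shifted index set
  have h1 : latticeDistStr ρ β L a O m (translateMulti (a • siteToE v) F) = ∑ y ∈ S₂, g y := by
    rw [latticeDistStr_apply, Finset.sum_map]
    refine Finset.sum_congr rfl fun x _ => ?_
    have hx : e x = fun i => x i + -v := by
      funext i; simp [he, hvv, sub_eq_add_neg]
    simp only [hg, Equiv.coe_toEmbedding, hx, translateMulti_apply, torusMomentStr_add_const]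
    congr 2
    funext i
    rw [← sub_eq_add_neg, Summit.QuantumFields.YangMills.Theorems.OSLegsFromFemtoAndGap.siteToE_sub, smul_sub]
  have h2 : latticeDistStr ρ β L a O m F = ∑ y ∈ S₁, g y := latticeDistStr_apply ρ β L a O m F
  rw [h1, h2, ← Finset.sum_sdiff_sub_sum_sdiff]
  -- Step 2: sizes
  have hainv : (1 : ℝ) ≤ a⁻¹ := one_le_inv_iff₀.2 ⟨ha, ha1⟩
  have hL1 : (1 : ℝ) ≤ L := le_trans (by nlinarith) hLa
  have haaL : (1 : ℝ) ≤ a * a * L := by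
    have := mul_le_mul_of_nonneg_left hLa (show (0 : ℝ) ≤ a * a by positivity)
    rwa [show a * a * (a⁻¹ * a⁻¹) = 1 by field_simp] at this
  set t : ℝ := a * L / 2 with ht
  have htpos : 0 < t := by positivity
  set B : ℝ := M ^ n * (SchwartzMap.seminorm ℂ (8 * n + J + 1) 0 F / t ^ (8 * n + J + 1)) with hB
  have hB0 : 0 ≤ B := by positivity
  -- Step 3: per-term bound in the wrap zone
  have hterm : ∀ y : Fin n → Site 4, (∃ i, (L : ℝ) < 2 * ‖y i‖) → ‖g y‖ ≤ B := by
    rintro y ⟨i, hi⟩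
    rw [hg]; dsimp only
    rw [norm_mul, Complex.norm_real, Real.norm_eq_abs, hB]
    refine mul_le_mul (hW y) ?_ (norm_nonneg _) (pow_nonneg hM n)
    refine norm_apply_le_seminorm_div F (8 * n + J + 1) htpos i ?_
    have := mul_norm_le_norm_smul_siteToE ha.le (y i)
    have : t ≤ a * ‖y i‖ := by rw [ht]; nlinarith
    linarith
  have hA : ∀ y ∈ S₂ \ S₁, ∃ i, (L : ℝ) < 2 * ‖y i‖ := by
    intro y hy
    rw [Finset.mem_sdiff] at hy
    obtain ⟨i, hi⟩ := exists_lt_norm_of_not_mem_piFinset_box hy.2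
    exact ⟨i, by linarith [norm_nonneg (y i)]⟩
  have hBset : ∀ y ∈ S₁ \ S₂, ∃ i, (L : ℝ) < 2 * ‖y i‖ := by
    intro y hy
    rw [Finset.mem_sdiff] at hy
    have hy2 : y + vv ∉ S₁ := by
      intro h
      apply hy.2
      rw [hS₂, Finset.mem_map_equiv]
      have : e.symm y = y + vv := by funext i; simp [he]
      rwa [this]
    obtain ⟨i, hi⟩ := exists_lt_norm_of_not_mem_piFinset_box hy2
    refine ⟨i, ?_⟩
    have h3 : ‖(y + vv) i‖ ≤ ‖y i‖ + ‖v‖ := by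
      simpa [hvv] using norm_add_le (y i) v
    linarith
  -- Step 4: sum the bounds
  have hcard₁ : (S₁.card : ℝ) = ((2 * L + 1 : ℕ) : ℝ) ^ (4 * n) := by
    rw [hS₁, Fintype.card_piFinset, Finset.prod_const, Finset.card_univ, Fintype.card_fin,
      Literature.Probability.LatticeModels.card_box, ← pow_mul]
    push_cast
    ring
  have hcard₂ : (S₂.card : ℝ) = ((2 * L + 1 : ℕ) : ℝ) ^ (4 * n) := by
    rw [hS₂, Finset.card_map, hcard₁]
  have hsum₁ : ‖∑ y ∈ S₂ \ S₁, g y‖ ≤ ((2 * L + 1 : ℕ) : ℝ) ^ (4 * n) * B := by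
    calc ‖∑ y ∈ S₂ \ S₁, g y‖ ≤ ∑ y ∈ S₂ \ S₁, ‖g y‖ := norm_sum_le _ _
      _ ≤ ∑ _y ∈ S₂ \ S₁, B := Finset.sum_le_sum fun y hy => hterm y (hA y hy)
      _ = ((S₂ \ S₁).card : ℝ) * B := by rw [Finset.sum_const, nsmul_eq_mul]
      _ ≤ (S₂.card : ℝ) * B := by gcongr; exact Finset.sdiff_subset
      _ = _ := by rw [hcard₂]
  have hsum₂ : ‖∑ y ∈ S₁ \ S₂, g y‖ ≤ ((2 * L + 1 : ℕ) : ℝ) ^ (4 * n) * B := by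
    calc ‖∑ y ∈ S₁ \ S₂, g y‖ ≤ ∑ y ∈ S₁ \ S₂, ‖g y‖ := norm_sum_le _ _
      _ ≤ ∑ _y ∈ S₁ \ S₂, B := Finset.sum_le_sum fun y hy => hterm y (hBset y hy)
      _ = ((S₁ \ S₂).card : ℝ) * B := by rw [Finset.sum_const, nsmul_eq_mul]
      _ ≤ (S₁.card : ℝ) * B := by gcongr; exact Finset.sdiff_subset
      _ = _ := by rw [hcard₁]
  -- Step 5: the arithmetic `(2L+1)^{4n} / t^{8n+J+1} ≤ 3^{4n} 2^{8n+J+1} a^{J+1}` (uses `L ≥ a⁻²`)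
  have key : ((2 * L + 1 : ℕ) : ℝ) ^ (4 * n) ≤ 3 ^ (4 * n) * a ^ (J + 1) * (a * L) ^ (8 * n + J + 1) := by
    have h3 : ((2 * L + 1 : ℕ) : ℝ) ≤ 3 * L := by push_cast; linarith
    calc ((2 * L + 1 : ℕ) : ℝ) ^ (4 * n) ≤ (3 * (L : ℝ)) ^ (4 * n) := pow_le_pow_left₀ (by positivity) h3 _
      _ = 3 ^ (4 * n) * (L : ℝ) ^ (4 * n) := mul_pow _ _ _
      _ ≤ 3 ^ (4 * n) * (L : ℝ) ^ (4 * n) * (a * a * L) ^ (4 * n + J + 1) :=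
          le_mul_of_one_le_right (by positivity) (one_le_pow₀ haaL)
      _ = 3 ^ (4 * n) * a ^ (J + 1) * (a * L) ^ (8 * n + J + 1) := by ring
  have hfinal : 2 * ((2 * L + 1 : ℕ) : ℝ) ^ (4 * n) * B ≤
      2 * 3 ^ (4 * n) * 2 ^ (8 * n + J + 1) * M ^ n * SchwartzMap.seminorm ℂ (8 * n + J + 1) 0 F *
        a ^ (J + 1) := by
    have htpow : t ^ (8 * n + J + 1) = (a * L) ^ (8 * n + J + 1) / 2 ^ (8 * n + J + 1) := by
      rw [ht, div_pow]
    have haL : 0 < (a * L) ^ (8 * n + J + 1) := by positivity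
    rw [hB, htpow, div_div_eq_mul_div]
    rw [show 2 * ((2 * L + 1 : ℕ) : ℝ) ^ (4 * n) *
        (M ^ n * (SchwartzMap.seminorm ℂ (8 * n + J + 1) 0 F * 2 ^ (8 * n + J + 1) / (a * L) ^ (8 * n + J + 1))) =
        2 * M ^ n * SchwartzMap.seminorm ℂ (8 * n + J + 1) 0 F * 2 ^ (8 * n + J + 1) *
          (((2 * L + 1 : ℕ) : ℝ) ^ (4 * n) / (a * L) ^ (8 * n + J + 1)) by ring]
    have hq : ((2 * L + 1 : ℕ) : ℝ) ^ (4 * n) / (a * L) ^ (8 * n + J + 1) ≤ 3 ^ (4 * n) * a ^ (J + 1) := by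
      rw [div_le_iff₀ haL]; linarith [key]
    calc 2 * M ^ n * SchwartzMap.seminorm ℂ (8 * n + J + 1) 0 F * 2 ^ (8 * n + J + 1) *
          (((2 * L + 1 : ℕ) : ℝ) ^ (4 * n) / (a * L) ^ (8 * n + J + 1))
        ≤ 2 * M ^ n * SchwartzMap.seminorm ℂ (8 * n + J + 1) 0 F * 2 ^ (8 * n + J + 1) *
          (3 ^ (4 * n) * a ^ (J + 1)) := by
          gcongr
      _ = _ := by ring
  calc ‖∑ y ∈ S₂ \ S₁, g y - ∑ y ∈ S₁ \ S₂, g y‖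
      ≤ ‖∑ y ∈ S₂ \ S₁, g y‖ + ‖∑ y ∈ S₁ \ S₂, g y‖ := norm_sub_le _ _
    _ ≤ ((2 * L + 1 : ℕ) : ℝ) ^ (4 * n) * B + ((2 * L + 1 : ℕ) : ℝ) ^ (4 * n) * B := add_le_add hsum₁ hsum₂
    _ = 2 * ((2 * L + 1 : ℕ) : ℝ) ^ (4 * n) * B := by ring
    _ ≤ _ := hfinal

end Defect

/-! ### Translation invariance of a limit from asymptotic invariance (fixed arity, additive functionals) -/

/-- **Translation invariance of the limit from asymptotic invariance along the sequence** (the tree's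
`translateMulti_apply_eq_of_tendsto`, restated for ONE arity and a sequence of merely additive functionals `S j`,
e.g. scalar multiples of lattice distributions): if `S j F → T F` on `⁰𝒮ₙ` with a uniform bound
`‖S j F‖ ≤ σ |F|_m` (`j` large), `b j → a`, and `S j (F(· - b j)) - S j F → 0` on `⁰𝒮ₙ`, then
`T (F(· - a)) = T F` on `⁰𝒮ₙ` (equicontinuity + strong continuity of translations on `𝓢`). -/
theorem translate_eq_of_asymptotic {n : ℕ} {S : ℕ → 𝓢((Fin n → E4), ℂ) → ℂ}
    (hS : ∀ (j : ℕ) (F₁ F₂ : 𝓢((Fin n → E4), ℂ)), S j (F₁ - F₂) = S j F₁ - S j F₂)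
    (T : 𝓢((Fin n → E4), ℂ) →L[ℂ] ℂ)
    (hconv : ∀ F : 𝓢((Fin n → E4), ℂ), IsOffDiagonal F → Tendsto (fun j => S j F) atTop (𝓝 (T F)))
    {σ : ℝ} {m : ℕ}
    (hb : ∀ᶠ j in atTop, ∀ F : 𝓢((Fin n → E4), ℂ), IsOffDiagonal F → ‖S j F‖ ≤ σ * schwartzNorm m F)
    {a : E4} {b : ℕ → E4} (hba : Tendsto b atTop (𝓝 a))
    (hinv : ∀ F : 𝓢((Fin n → E4), ℂ), IsOffDiagonal F →
      Tendsto (fun j => S j (translateMulti (b j) F) - S j F) atTop (𝓝 0))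
    (F : 𝓢((Fin n → E4), ℂ)) (hF : IsOffDiagonal F) : T (translateMulti a F) = T F := by
  -- adapted from `Literature/…/SchwingerLimitInheritance.lean`, `translateMulti_apply_eq_of_tendsto`
  have hτ : Tendsto (fun j => translateMulti (b j) F) atTop (𝓝 (translateMulti a F)) :=
    ((continuous_translateMulti F).tendsto a).comp hba
  have hqc : Continuous fun G : 𝓢((Fin n → E4), ℂ) => schwartzNorm m G :=
    Seminorm.continuous_finsetSup (s := Finset.Iic (m, m)) fun i _ =>
      (schwartz_withSeminorms ℂ (Fin n → E4) ℂ).continuous_seminorm i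
  have h1 : Tendsto (fun j => translateMulti a F - translateMulti (b j) F) atTop (𝓝 0) := by
    simpa using (tendsto_const_nhds (x := translateMulti a F)).sub hτ
  have hN : Tendsto (fun j => schwartzNorm m (translateMulti a F - translateMulti (b j) F))
      atTop (𝓝 0) := by
    have h2 := (hqc.tendsto 0).comp h1
    rwa [show schwartzNorm m (0 : 𝓢((Fin n → E4), ℂ)) = 0 from map_zero _] at h2
  -- equicontinuity: `S j (F(· - a)) - S j (F(· - b j)) → 0`
  have h3 : Tendsto (fun j => S j (translateMulti a F - translateMulti (b j) F)) atTop (𝓝 0) := by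
    refine squeeze_zero_norm' (hb.mono fun j hj => hj _ ((hF.translateMulti a).sub
      (hF.translateMulti (b j)))) ?_
    simpa using hN.const_mul σ
  -- hence `S j (F(· - a)) - S j F → 0`
  have h4 : Tendsto (fun j => S j (translateMulti a F) - S j F) atTop (𝓝 0) := by
    have h5 := h3.add (hinv F hF)
    rw [add_zero] at h5
    refine h5.congr' (Eventually.of_forall fun j => ?_)
    rw [hS]
    ring
  have h6 : T (translateMulti a F) - T F = 0 :=
    tendsto_nhds_unique ((hconv _ (hF.translateMulti a)).sub (hconv F hF)) h4
  exact sub_eq_zero.1 h6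

/-! ### The stub -/

/-- SG6 (worker): translation invariance of scaled subsequential limits of plane-string distributions (lattice
vectors `a_k⌊t/a_k⌋ → t`: exact torus-shift invariance + wrap defect `O(a_k^{J+1})` against the scalar `λ_k ≤ a_k^{-J}`;
the remainder by the k-uniform bound and continuity of translations in `𝓢`). -/
theorem translate_scaledLimit :
    ∀ (G : Type) [Group G] [TopologicalSpace G] [IsTopologicalGroup G] [CompactSpace G] [MeasurableSpace G]
      [BorelSpace G] (r : LatticeRep G) (n : ℕ) (q : Fin n → Fin 4 × Fin 4) (βs : ℕ → ℝ) (Ls : ℕ → ℕ)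
      (as lam : ℕ → ℝ) (J sn : ℕ) (Bn : ℝ)
      (Φ : 𝓢((Fin n → EuclideanSpace ℝ (Fin 4)), ℂ) →L[ℂ] ℂ),
      (∀ k, 0 < as k) → (∀ k, as k ≤ 1) → Tendsto as atTop (𝓝 0) → (∀ k, (as k)⁻¹ * (as k)⁻¹ ≤ (Ls k : ℝ)) →
      (∀ k, |lam k| ≤ ((as k)⁻¹) ^ J) →
      (∀ᶠ k in atTop, ∀ F : 𝓢((Fin n → EuclideanSpace ℝ (Fin 4)), ℂ), IsOffDiagonal F →
        ‖((lam k : ℝ) : ℂ) *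
          latticeDistStr r.ρ (βs k) (Ls k) (as k) (fun i => planeObs r (q i))
            (fun i => wilsonTorusMean r.ρ (βs k) (Ls k) (planeObs r (q i))) F‖ ≤ Bn * schwartzNorm sn F) →
      (∀ F : 𝓢((Fin n → EuclideanSpace ℝ (Fin 4)), ℂ), IsOffDiagonal F →
        Tendsto (fun k => ((lam k : ℝ) : ℂ) *
          latticeDistStr r.ρ (βs k) (Ls k) (as k) (fun i => planeObs r (q i))
            (fun i => wilsonTorusMean r.ρ (βs k) (Ls k) (planeObs r (q i))) F) atTop (𝓝 (Φ F))) →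
      ∀ (t : EuclideanSpace ℝ (Fin 4)) (F : 𝓢((Fin n → EuclideanSpace ℝ (Fin 4)), ℂ)), IsOffDiagonal F →
        Φ (translateMulti t F) = Φ F := by
  intro G _ _ _ _ _ _ r n q βs Ls as lam J sn Bn Φ ha ha1 ha0 hLa hlam hb hconv t F hF
  -- lattice approximants `b j = a_j ⌊t/a_j⌋ → t`
  set v : ℕ → Site 4 := fun j k => ⌊t k / as j⌋ with hv
  set b : ℕ → E4 := fun j => as j • siteToE (v j) with hbdef
  have hba : Tendsto b atTop (𝓝 t) := by
    rw [tendsto_iff_norm_sub_tendsto_zero]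
    refine squeeze_zero (fun j => norm_nonneg _) (fun j => norm_smul_siteToE_floor_sub_le t (ha j)) ?_
    simpa using ha0.const_mul 2
  refine translate_eq_of_asymptotic
    (S := fun k F' => ((lam k : ℝ) : ℂ) *
      latticeDistStr r.ρ (βs k) (Ls k) (as k) (fun i => planeObs r (q i))
        (fun i => wilsonTorusMean r.ρ (βs k) (Ls k) (planeObs r (q i))) F')
    (fun k F₁ F₂ => by simp only [map_sub, mul_sub]) Φ hconv hb hba (fun F' hF' => ?_) F hF
  -- eventually `2‖v_j‖ ≤ L_j` (since `‖v_j‖ ≤ ‖t‖/a_j + 1` and `L_j ≥ a_j⁻²`)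
  have hev : ∀ᶠ j in atTop, 2 * ‖v j‖ ≤ (Ls j : ℝ) := by
    have h1 : Tendsto (fun j => 2 * ‖t‖ * as j + 2 * (as j * as j)) atTop (𝓝 0) := by
      simpa using ((ha0.const_mul (2 * ‖t‖)).add ((ha0.mul ha0).const_mul 2))
    have h2 : ∀ᶠ j in atTop, 2 * ‖t‖ * as j + 2 * (as j * as j) ≤ 1 :=
      (h1.eventually (ge_mem_nhds one_pos)).mono fun j hj => hj
    refine h2.mono fun j hj => ?_
    have hvj := norm_floor_le t (ha j)
    have haj := ha j
    have hLj := hLa j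
    have h3 : 2 * (‖t‖ / as j + 1) ≤ (as j)⁻¹ * (as j)⁻¹ := by
      rw [div_eq_mul_inv]
      have hinv : 0 < (as j)⁻¹ := inv_pos.2 haj
      have key : (2 * ‖t‖ * as j + 2 * (as j * as j)) * ((as j)⁻¹ * (as j)⁻¹) ≤ 1 * ((as j)⁻¹ * (as j)⁻¹) :=
        mul_le_mul_of_nonneg_right hj (by positivity)
      have hexp : (2 * ‖t‖ * as j + 2 * (as j * as j)) * ((as j)⁻¹ * (as j)⁻¹) =
          2 * (‖t‖ * (as j)⁻¹ + 1) := by field_simp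
      linarith [hexp ▸ key]
    calc 2 * ‖v j‖ ≤ 2 * (‖t‖ / as j + 1) := by rw [hv]; linarith [hvj]
      _ ≤ (as j)⁻¹ * (as j)⁻¹ := h3
      _ ≤ Ls j := hLj
  -- sup bound `(2Cₚ)ⁿ` on the plane-string weights
  obtain ⟨Cp, hCp⟩ := exists_abs_plane_le (G := G) r
  have hCp0 : 0 ≤ Cp := le_trans (abs_nonneg _) (hCp (0, 1) 0 (fun _ => 1))
  have hM : (0 : ℝ) ≤ Cp + Cp := by positivity
  have hW : ∀ (j : ℕ) (x : Fin n → Site 4),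
      |torusMomentStr r.ρ (βs j) (Ls j) (fun i => planeObs r (q i))
        (fun i => wilsonTorusMean r.ρ (βs j) (Ls j) (planeObs r (q i))) x| ≤ (Cp + Cp) ^ n :=
    fun j x => abs_torusMomentStr_plane_le r hCp (βs j) (Ls j) q x
  -- the scaled defect is `O(a_j)`: `|λ_j| · O(a_j^{J+1}) ≤ a_j^{-J} · O(a_j^{J+1})`
  set C : ℝ := 2 * 3 ^ (4 * n) * 2 ^ (8 * n + J + 1) * (Cp + Cp) ^ n *
    SchwartzMap.seminorm ℂ (8 * n + J + 1) 0 F' with hC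
  have hbound : ∀ᶠ j in atTop,
      ‖((lam j : ℝ) : ℂ) *
            latticeDistStr r.ρ (βs j) (Ls j) (as j) (fun i => planeObs r (q i))
              (fun i => wilsonTorusMean r.ρ (βs j) (Ls j) (planeObs r (q i))) (translateMulti (b j) F') -
          ((lam j : ℝ) : ℂ) *
            latticeDistStr r.ρ (βs j) (Ls j) (as j) (fun i => planeObs r (q i))
              (fun i => wilsonTorusMean r.ρ (βs j) (Ls j) (planeObs r (q i))) F'‖ ≤ C * as j :=
    hev.mono fun j hj => by
      rw [← mul_sub, norm_mul, Complex.norm_real, Real.norm_eq_abs]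
      have hdef := norm_latticeDistStr_translate_sub_le_pow r.ρ (βs j) (Ls j) (fun i => planeObs r (q i))
        (fun i => wilsonTorusMean r.ρ (βs j) (Ls j) (planeObs r (q i))) hM (hW j) (ha j) (ha1 j) (hLa j)
        (v j) hj J F'
      have hpow : (as j)⁻¹ ^ J * as j ^ (J + 1) = as j := by
        rw [pow_succ, ← mul_assoc, ← mul_pow, inv_mul_cancel₀ (ha j).ne', one_pow, one_mul]
      calc |lam j| * ‖latticeDistStr r.ρ (βs j) (Ls j) (as j) (fun i => planeObs r (q i))
                (fun i => wilsonTorusMean r.ρ (βs j) (Ls j) (planeObs r (q i))) (translateMulti (b j) F') -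
              latticeDistStr r.ρ (βs j) (Ls j) (as j) (fun i => planeObs r (q i))
                (fun i => wilsonTorusMean r.ρ (βs j) (Ls j) (planeObs r (q i))) F'‖
          ≤ (as j)⁻¹ ^ J * (C * as j ^ (J + 1)) :=
            mul_le_mul (hlam j) hdef (norm_nonneg _) (pow_nonneg (inv_nonneg.2 (ha j).le) J)
        _ = C * ((as j)⁻¹ ^ J * as j ^ (J + 1)) := by ring
        _ = C * as j := by rw [hpow]
  refine squeeze_zero_norm' hbound ?_
  simpa using ha0.const_mul C

end Summit.QuantumFields.YangMills.Cruxes.HypercubicLimit.ConditionalMeanTelescoping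

end
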